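import Mathlib
import HarnessLib
import Summits.HubbardSuperconductivity.HubbardSuperconductivity.Theorems.KLProgrammeKLRegimeVolumeLimitSixHamiltonian
import Summits.HubbardSuperconductivity.HubbardSuperconductivity.Theorems.KLProgrammeThermalGreenLehmannDecay

/-!
# LABEL DECAY of the cutoff-free six-point scalar and the HARTREE SUM RULE with a volume-uniform remainder:
# `‖Six∞_L(n,p)‖ ≤ 9/(2|k₀(n)|)` and `‖Σ∞⁰_L(n,p) − U·occ∞(L)‖ ≤ 9U²/(2|k₀(n)|)`, uniformly in `L ≥ 3`, `p`, `μ`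
# (seat hubbard-kl-k3c5-p1 g5, technique «stub_asm_matsubara suppliers»; VL child `KLRegimeVolumeLimitV14`, stmt-HubbardSuperconductivity-19921)

`…VolumeLimitSixHamiltonian` (this seat): `Six∞_L(n,p) = −∫₀^β e^{ik₀(n)τ}⟨T′_{−p}(τ)T′†_{−p}⟩_{H′}dτ` with the half-shifted dressed mode `T′`,
`‖T′‖ ≤ 3/2`.  `…ThermalGreenLehmannDecay` (this seat): a fermionic Matsubara transform of a thermal AUTOCORRELATION decays like
`2‖A‖²/|k|` by positivity of its Lehmann weights — no commutator, uniform in the system size.  Hence: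

* `norm_klSixInf_le_div` — `U ≠ 0`: **`‖klSixInf L β U μ n p‖ ≤ 9/(2·|k₀(n)|)`**, `k₀(n) = fermiMatsubara β n = π(2n+1)/β`, for every `L ≥ 3`,
  `β > 0`, `μ`, `p` — decay in the Matsubara LABEL, uniform in the volume, the momentum and the coupling (with `norm_klSixInf_le_beta`:
  `‖Six∞‖ ≤ min(9β/4, 9/(2|k₀|))`);
* `norm_klSelfEnergyInf_zero_sub_hartree_le` — EVERY `U`: **`‖Σ∞⁰_L(n,p) − U·occ∞(L)‖ ≤ 9U²/(2|k₀(n)|)`** — the first-moment (Hartree) sum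
  rule of the bare cutoff-free VL carrier with an `L`-UNIFORM remainder: at large Matsubara label the carrier is the (volume-dependent) Hartree
  constant `U·(⟨n_{0↓}⟩_L − ½)` up to `O(U²/ω_n)`;
* `norm_klSelfEnergyInf_zero_sub_sub_le` — consequently the two-volume difference of the carrier is the two-volume difference of the density up to
  `9U²/|k₀(n)|`: `‖(Σ∞⁰_L(n,p) − Σ∞⁰_{L′}(n,p′)) − U·(occ∞(L) − occ∞(L′))‖ ≤ 9U²/|k₀(n)|` — the LABEL TAIL of `stub_vl_carrierRate`: beyond
  `|n| ≈ U²/ε` the carrier's two-volume rate IS the density's, so a label-uniform rate needs per-label control only on a finite label window.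

Everything is proved; no definition.
-/

noncomputable section

namespace Summit.HubbardSuperconductivity.HubbardSuperconductivity.Theorems.TwoPointAssembly

set_option linter.dupNamespace false -- summit = problem name (single-conjunct summit), D-0017

open Finset Filter Topology MeasureTheory intervalIntegral Complex Literature.MathematicalPhysics.QuantumLattice Literature.Probability.LatticeModels
  GrassmannAlgebra
open Summit.HubbardSuperconductivity.HubbardSuperconductivity.Theorems.ThermalGreen
open Summit.HubbardSuperconductivity.HubbardSuperconductivity.Theorems.MatsubaraAllU
open Summit.HubbardSuperconductivity.HubbardSuperconductivity.Theorems.KLRegimeSplit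
open Summit.HubbardSuperconductivity.HubbardSuperconductivity.Theorems.KLProgrammeLegKernels
open scoped ComplexConjugate ComplexOrder Matrix.Norms.L2Operator Matrix

variable {L : ℕ} [NeZero L]

/-- **LABEL DECAY: `‖Six∞_L(n,p)‖ ≤ 9/(2|k₀(n)|)`** (`U ≠ 0`, `L ≥ 3`, `β > 0`; `k₀(n) = π(2n+1)/β`), uniform in the volume, the momentum and the
coupling — Lehmann decay of the dressed-mode autocorrelation (`‖T′‖ ≤ 3/2`, `2·(3/2)² = 9/2`). -/
theorem norm_klSixInf_le_div (hL : 3 ≤ L) {β : ℝ} (hβ : 0 < β) {U : ℝ} (hU : U ≠ 0) (μ : ℝ) (n : ℤ) (p : TorusSite 2 L) :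
    ‖klSixInf L β U μ n p‖ ≤ 9 / (2 * |fermiMatsubara β n|) := by
  haveI : Nonempty (Finset (Orb (FermionTorus 2 L))) := ⟨∅⟩
  have hH := isHermitian_hamiltonianWith (fermionTorusGraph 2 L) 1 U (μ + U / 2)
  rw [klSixInf_eq_neg_shiftedDressedMatsubara hL hβ hU μ n p, norm_neg]
  have h := norm_matsubara_autocorrelation_le_fermi (H := hubbardTorusWith 2 L 1 U (μ + U / 2)) hH hβ ((∑ z : FermionTorus 2 L, (torusFourierWeight 2 L * torusChar (-p) z.toTorusSite) • (numberOp z 1 * creation (orb z 0)))ᴴ - (1 / 2 : ℂ) • momentumAnnihilation (-p) 0) n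
  simp only [fermiMatsubara] at h ⊢
  refine h.trans ?_
  have hT := norm_shiftedDressed_le (L := L) (-p)
  have hk : 0 < |Real.pi * (2 * (n : ℝ) + 1) / β| := by
    have := Literature.MathematicalPhysics.QuantumLattice.pi_div_le_abs_fermiMatsubara hβ n
    simp only [fermiMatsubara] at this
    exact lt_of_lt_of_le (div_pos Real.pi_pos hβ) this
  rw [div_le_div_iff₀ hk (by positivity)]
  have h0 : 0 ≤ ‖((∑ z : FermionTorus 2 L, (torusFourierWeight 2 L * torusChar (-p) z.toTorusSite) • (numberOp z 1 * creation (orb z 0)))ᴴ - (1 / 2 : ℂ) • momentumAnnihilation (-p) 0)‖ := norm_nonneg _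
  have hT2 := pow_le_pow_left₀ h0 hT 2
  nlinarith [hT2, hk]

/-- **HARTREE SUM RULE WITH A VOLUME-UNIFORM REMAINDER: `‖Σ∞⁰_L(n,p) − U·occ∞(L)‖ ≤ 9U²/(2|k₀(n)|)`** for EVERY real `U`, `L ≥ 3`, `β > 0`, `μ`,
`n`, `p` (`Σ∞⁰ − U·occ∞ = U²·Six∞`). -/
theorem norm_klSelfEnergyInf_zero_sub_hartree_le (hL : 3 ≤ L) {β : ℝ} (hβ : 0 < β) (U μ : ℝ) (n : ℤ) (p : TorusSite 2 L) :
    ‖klSelfEnergyInf L β U μ 0 n p - (U : ℂ) * klOccInf L β U μ‖ ≤ 9 * U ^ 2 / (2 * |fermiMatsubara β n|) := by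
  rw [klSelfEnergyInf_zero_frame hβ.ne' U μ n p, add_sub_cancel_left, norm_mul, norm_pow, Complex.norm_real, Real.norm_eq_abs, sq_abs]
  by_cases hU : U = 0
  · subst hU; simp
  · have h := norm_klSixInf_le_div hL hβ hU μ n p
    have hU2 : 0 ≤ U ^ 2 := sq_nonneg U
    calc U ^ 2 * ‖klSixInf L β U μ n p‖ ≤ U ^ 2 * (9 / (2 * |fermiMatsubara β n|)) := mul_le_mul_of_nonneg_left h hU2
      _ = 9 * U ^ 2 / (2 * |fermiMatsubara β n|) := by ring

/-- **THE LABEL TAIL OF THE TWO-VOLUME RATE**: for EVERY `U`, `L, L′ ≥ 3`, `β > 0`, `μ`, `n`, `p`, `p′`,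
`‖(Σ∞⁰_L(n,p) − Σ∞⁰_{L′}(n,p′)) − U·(occ∞(L) − occ∞(L′))‖ ≤ 9U²/|k₀(n)|` — at large Matsubara label the carrier's two-volume difference is the
density's, uniformly in both volumes and both momenta. -/
theorem norm_klSelfEnergyInf_zero_sub_sub_le (hL : 3 ≤ L) {L' : ℕ} [NeZero L'] (hL' : 3 ≤ L') {β : ℝ} (hβ : 0 < β) (U μ : ℝ) (n : ℤ)
    (p : TorusSite 2 L) (p' : TorusSite 2 L') :
    ‖(klSelfEnergyInf L β U μ 0 n p - klSelfEnergyInf L' β U μ 0 n p') -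
        (U : ℂ) * (klOccInf L β U μ - klOccInf L' β U μ)‖ ≤ 9 * U ^ 2 / |fermiMatsubara β n| := by
  have h1 := norm_klSelfEnergyInf_zero_sub_hartree_le hL hβ U μ n p
  have h2 := norm_klSelfEnergyInf_zero_sub_hartree_le hL' hβ U μ n p'
  calc ‖(klSelfEnergyInf L β U μ 0 n p - klSelfEnergyInf L' β U μ 0 n p') - (U : ℂ) * (klOccInf L β U μ - klOccInf L' β U μ)‖
      = ‖(klSelfEnergyInf L β U μ 0 n p - (U : ℂ) * klOccInf L β U μ) -
          (klSelfEnergyInf L' β U μ 0 n p' - (U : ℂ) * klOccInf L' β U μ)‖ := by ring_nf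
    _ ≤ ‖klSelfEnergyInf L β U μ 0 n p - (U : ℂ) * klOccInf L β U μ‖ +
          ‖klSelfEnergyInf L' β U μ 0 n p' - (U : ℂ) * klOccInf L' β U μ‖ := norm_sub_le _ _
    _ ≤ 9 * U ^ 2 / (2 * |fermiMatsubara β n|) + 9 * U ^ 2 / (2 * |fermiMatsubara β n|) := add_le_add h1 h2
    _ = 9 * U ^ 2 / |fermiMatsubara β n| := by ring

end Summit.HubbardSuperconductivity.HubbardSuperconductivity.Theorems.TwoPointAssembly

end
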